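import Summits.CriticalPhenomena.PercolationContinuityZ3.Theorems.Transplant.FKConnectivityAllQAntipodalRootFormBasePar

/-!
# Connectivity correlation inequalities for `φ_{w,q}`, every `q > 0` — ROOT-FORM CALCULUS, file 61j: base (B3), second half and assembly

Support file (`--supports stmt-CriticalPhenomena-4575`), FK sub-lane `prim-bschramm-fk-2` (gen 28); builds on p205010 (kernel theorem, internal audit
signed; external expert review pending).  Standard axioms, no sorries.  Continues file 61i: the `z`-half `certZ3_nonneg` of the (B3) certificate and
the theorem `serPair_parE_Mt_nonneg` — the nested root functional of `g ∥ (B_y · B_z)` is nonnegative against every monotone nested nonnegative weight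
pair, from the single-box inequalities A2/A3n/A4n of the two abstract boxes, the contracted AND of the series pair, and consistency of the local
types (memo FROM-fk-2-g28-ROOT-FORM.md §4, §6, §7). [folklore]
-/

noncomputable section

namespace Summit.CriticalPhenomena.PercolationContinuityZ3.Theorems

namespace FK

namespace RootForm

namespace BasePar

open Finset Base BaseSer

section Halves2

variable {B B' : Type*} [Fintype B] [Fintype B'] [Preorder B] [Preorder B']

omit [Fintype B] in
/-- **the `z`-half of the (B3) certificate is nonnegative** (per fixed `y`-configuration). (case `c⁰ = false` of the fibre). [folklore] -/
theorem certZ3_nonneg_f (Y : B → BDat) (Z : B' → BDat)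
    (hB2 : ∀ h : B' → ℝ, Monotone h → (∀ γ, 0 ≤ h γ) → ∀ K : ℤ, 0 ≤ ∑ γ, h γ * gA2 (Z γ) K)
    (hB3 : ∀ h0 h1 : B' → ℝ, Monotone h0 → Monotone h1 → (∀ γ, 0 ≤ h0 γ) → (∀ γ, h0 γ ≤ h1 γ) → ∀ K : ℤ,
      0 ≤ ∑ γ, (h1 γ * gA3u (Z γ) K + h0 γ * gA3l (Z γ) K))
    (hB4 : ∀ h0 h1 : B' → ℝ, Monotone h0 → Monotone h1 → (∀ γ, 0 ≤ h0 γ) → (∀ γ, h0 γ ≤ h1 γ) → ∀ K : ℤ,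
      0 ≤ ∑ γ, (h1 γ * gA4u (Z γ) K + h0 γ * gA4l (Z γ) K))
    {H0 H1 : Bool × (B × B') → ℝ} (m0 : Monotone H0) (m1 : Monotone H1) (n0 : ∀ p, 0 ≤ H0 p) (le : ∀ p, H0 p ≤ H1 p) (J : ℤ) (β : B) (hcv : (Y β).t0.c = false) :
    0 ≤ ∑ γ, (H1 (true, (β, γ)) * ((Cert.certZ3 (Y β).type (Z γ).type ((J - (Y β).t0.L - 1) - (Z γ).t0.L)
        ((J - (Y β).t1.L - 1) - (Z γ).t0.L)).1 : ℝ)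
      + H1 (false, (β, γ)) * ((Cert.certZ3 (Y β).type (Z γ).type ((J - (Y β).t0.L - 1) - (Z γ).t0.L)
        ((J - (Y β).t1.L - 1) - (Z γ).t0.L)).2.1 : ℝ)
      + H0 (true, (β, γ)) * ((Cert.certZ3 (Y β).type (Z γ).type ((J - (Y β).t0.L - 1) - (Z γ).t0.L)
        ((J - (Y β).t1.L - 1) - (Z γ).t0.L)).2.2.1 : ℝ)
      + H0 (false, (β, γ)) * ((Cert.certZ3 (Y β).type (Z γ).type ((J - (Y β).t0.L - 1) - (Z γ).t0.L)
        ((J - (Y β).t1.L - 1) - (Z γ).t0.L)).2.2.2 : ℝ)) := by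
  have n1 : ∀ p, 0 ≤ H1 p := fun p => (n0 p).trans (le p)
  have w11m := mono_midR m1 true β; have w10m := mono_midR m1 false β; have w01m := mono_midR m0 true β; have w00m := mono_midR m0 false β
  have l_10_11 : ∀ γ, H1 (false, (β, γ)) ≤ H1 (true, (β, γ)) := fun γ => mono_b m1 _
  have l_00_01 : ∀ γ, H0 (false, (β, γ)) ≤ H0 (true, (β, γ)) := fun γ => mono_b m0 _
  have l_00_10 : ∀ γ, H0 (false, (β, γ)) ≤ H1 (false, (β, γ)) := fun γ => le _
  have l_01_11 : ∀ γ, H0 (true, (β, γ)) ≤ H1 (true, (β, γ)) := fun γ => le _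
  have l_00_11 : ∀ γ, H0 (false, (β, γ)) ≤ H1 (true, (β, γ)) := fun γ => (le _).trans (mono_b m1 _)
  have i3 : ∀ (w0 w1 : B' → ℝ), Monotone w0 → Monotone w1 → (∀ γ, 0 ≤ w0 γ) → (∀ γ, w0 γ ≤ w1 γ) → ∀ K,
      0 ≤ ∑ γ, w1 γ * gA3u (Z γ) K + ∑ γ, w0 γ * gA3l (Z γ) K := fun w0 w1 a b c d K => by
    rw [← Finset.sum_add_distrib]; exact hB3 w0 w1 a b c d K
  have i4 : ∀ (w0 w1 : B' → ℝ), Monotone w0 → Monotone w1 → (∀ γ, 0 ≤ w0 γ) → (∀ γ, w0 γ ≤ w1 γ) → ∀ K,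
      0 ≤ ∑ γ, w1 γ * gA4u (Z γ) K + ∑ γ, w0 γ * gA4l (Z γ) K := fun w0 w1 a b c d K => by
    rw [← Finset.sum_add_distrib]; exact hB4 w0 w1 a b c d K
  have a := fun K => hB2 _ w11m (fun γ => n1 _) K; have b := fun K => hB2 _ w10m (fun γ => n1 _) K
  have c := fun K => hB2 _ w01m (fun γ => n0 _) K; have d := fun K => hB2 _ w00m (fun γ => n0 _) K
  have e := fun K => i3 _ _ w00m w01m (fun γ => n0 _) l_00_01 K; have f := fun K => i3 _ _ w00m w11m (fun γ => n0 _) l_00_11 K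
  have g := fun K => i3 _ _ w10m w11m (fun γ => n1 _) l_10_11 K; have h := fun K => i3 _ _ w00m w10m (fun γ => n0 _) l_00_10 K
  have e4 := fun K => i4 _ _ w00m w01m (fun γ => n0 _) l_00_01 K; have f4 := fun K => i4 _ _ w00m w11m (fun γ => n0 _) l_00_11 K
  have g4 := fun K => i4 _ _ w10m w11m (fun γ => n1 _) l_10_11 K; have h4 := fun K => i4 _ _ w00m w10m (fun γ => n0 _) l_00_10 K
  have b11 := fun K => i4 _ _ w11m w11m (fun γ => n1 _) (fun γ => le_rfl) K
  have b10 := fun K => i4 _ _ w10m w10m (fun γ => n1 _) (fun γ => le_rfl) K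
  have b01 := fun K => i4 _ _ w01m w01m (fun γ => n0 _) (fun γ => le_rfl) K
  have b00 := fun K => i4 _ _ w00m w00m (fun γ => n0 _) (fun γ => le_rfl) K
  have A := a (J - (Y β).t0.L - 1); have A' := a (J - (Y β).t1.L - 1); have Bq := b (J - (Y β).t0.L - 1); have Bq' := b (J - (Y β).t1.L - 1)
  have C := c (J - (Y β).t0.L - 1); have C' := c (J - (Y β).t1.L - 1); have D := d (J - (Y β).t0.L - 1); have D' := d (J - (Y β).t1.L - 1)
  have E := e (J - (Y β).t0.L - 1); have E' := e (J - (Y β).t1.L - 1); have Fq := f (J - (Y β).t0.L - 1); have Fq' := f (J - (Y β).t1.L - 1)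
  have G := g (J - (Y β).t0.L - 1); have G' := g (J - (Y β).t1.L - 1); have Hq := h (J - (Y β).t0.L - 1); have Hq' := h (J - (Y β).t1.L - 1)
  have E4 := e4 (J - (Y β).t0.L - 1); have E4' := e4 (J - (Y β).t1.L - 1); have F4 := f4 (J - (Y β).t0.L - 1); have F4' := f4 (J - (Y β).t1.L - 1)
  have G4 := g4 (J - (Y β).t0.L - 1); have G4' := g4 (J - (Y β).t1.L - 1); have H4 := h4 (J - (Y β).t0.L - 1); have H4' := h4 (J - (Y β).t1.L - 1)
  have B11 := b11 (J - (Y β).t0.L - 1); have B11' := b11 (J - (Y β).t1.L - 1); have B10 := b10 (J - (Y β).t0.L - 1); have B10' := b10 (J - (Y β).t1.L - 1)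
  have B01 := b01 (J - (Y β).t0.L - 1); have B01' := b01 (J - (Y β).t1.L - 1); have B00 := b00 (J - (Y β).t0.L - 1); have B00' := b00 (J - (Y β).t1.L - 1)
  clear a b c d e f g h e4 f4 g4 h4 b11 b10 b01 b00 i3 i4
  simp only [gA2, gA3u, gA3l, gA4u, gA4l] at A A' Bq Bq' C C' D D' E E' Fq Fq' G G' Hq Hq' E4 E4' F4 F4' G4 G4' H4 H4' B11 B11' B10 B10' B01 B01' B00 B00'
  generalize (Y β) = dy at *
  obtain ⟨⟨L0, c0, cb0⟩, ⟨L1, c1, cb1⟩⟩ := dy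
  simp only [BDat.type] at *
  subst hcv
  cases c1 <;> cases cb0 <;> cases cb1 <;>
    simp only [Cert.certZ3, Cert.isC, Prod.mk.injEq, Bool.false_eq_true, Bool.true_eq_false, and_true, and_false,
      and_self, ite_true, ite_false, zero_mul, one_mul, mul_zero, mul_one, zero_add, add_zero, two_mul, three_mul', four_mul',
      Int.cast_add, Int.cast_zero, mul_add, Finset.sum_add_distrib] <;>
    first | positivity | linarith

omit [Fintype B] in
/-- **the `z`-half of the (B3) certificate is nonnegative** (per fixed `y`-configuration). (case `c⁰ = true` of the fibre). [folklore] -/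
theorem certZ3_nonneg_t (Y : B → BDat) (Z : B' → BDat)
    (hB2 : ∀ h : B' → ℝ, Monotone h → (∀ γ, 0 ≤ h γ) → ∀ K : ℤ, 0 ≤ ∑ γ, h γ * gA2 (Z γ) K)
    (hB3 : ∀ h0 h1 : B' → ℝ, Monotone h0 → Monotone h1 → (∀ γ, 0 ≤ h0 γ) → (∀ γ, h0 γ ≤ h1 γ) → ∀ K : ℤ,
      0 ≤ ∑ γ, (h1 γ * gA3u (Z γ) K + h0 γ * gA3l (Z γ) K))
    (hB4 : ∀ h0 h1 : B' → ℝ, Monotone h0 → Monotone h1 → (∀ γ, 0 ≤ h0 γ) → (∀ γ, h0 γ ≤ h1 γ) → ∀ K : ℤ,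
      0 ≤ ∑ γ, (h1 γ * gA4u (Z γ) K + h0 γ * gA4l (Z γ) K))
    {H0 H1 : Bool × (B × B') → ℝ} (m0 : Monotone H0) (m1 : Monotone H1) (n0 : ∀ p, 0 ≤ H0 p) (le : ∀ p, H0 p ≤ H1 p) (J : ℤ) (β : B) (hcv : (Y β).t0.c = true) :
    0 ≤ ∑ γ, (H1 (true, (β, γ)) * ((Cert.certZ3 (Y β).type (Z γ).type ((J - (Y β).t0.L - 1) - (Z γ).t0.L)
        ((J - (Y β).t1.L - 1) - (Z γ).t0.L)).1 : ℝ)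
      + H1 (false, (β, γ)) * ((Cert.certZ3 (Y β).type (Z γ).type ((J - (Y β).t0.L - 1) - (Z γ).t0.L)
        ((J - (Y β).t1.L - 1) - (Z γ).t0.L)).2.1 : ℝ)
      + H0 (true, (β, γ)) * ((Cert.certZ3 (Y β).type (Z γ).type ((J - (Y β).t0.L - 1) - (Z γ).t0.L)
        ((J - (Y β).t1.L - 1) - (Z γ).t0.L)).2.2.1 : ℝ)
      + H0 (false, (β, γ)) * ((Cert.certZ3 (Y β).type (Z γ).type ((J - (Y β).t0.L - 1) - (Z γ).t0.L)
        ((J - (Y β).t1.L - 1) - (Z γ).t0.L)).2.2.2 : ℝ)) := by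
  have n1 : ∀ p, 0 ≤ H1 p := fun p => (n0 p).trans (le p)
  have w11m := mono_midR m1 true β; have w10m := mono_midR m1 false β; have w01m := mono_midR m0 true β; have w00m := mono_midR m0 false β
  have l_10_11 : ∀ γ, H1 (false, (β, γ)) ≤ H1 (true, (β, γ)) := fun γ => mono_b m1 _
  have l_00_01 : ∀ γ, H0 (false, (β, γ)) ≤ H0 (true, (β, γ)) := fun γ => mono_b m0 _
  have l_00_10 : ∀ γ, H0 (false, (β, γ)) ≤ H1 (false, (β, γ)) := fun γ => le _
  have l_01_11 : ∀ γ, H0 (true, (β, γ)) ≤ H1 (true, (β, γ)) := fun γ => le _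
  have l_00_11 : ∀ γ, H0 (false, (β, γ)) ≤ H1 (true, (β, γ)) := fun γ => (le _).trans (mono_b m1 _)
  have i3 : ∀ (w0 w1 : B' → ℝ), Monotone w0 → Monotone w1 → (∀ γ, 0 ≤ w0 γ) → (∀ γ, w0 γ ≤ w1 γ) → ∀ K,
      0 ≤ ∑ γ, w1 γ * gA3u (Z γ) K + ∑ γ, w0 γ * gA3l (Z γ) K := fun w0 w1 a b c d K => by
    rw [← Finset.sum_add_distrib]; exact hB3 w0 w1 a b c d K
  have i4 : ∀ (w0 w1 : B' → ℝ), Monotone w0 → Monotone w1 → (∀ γ, 0 ≤ w0 γ) → (∀ γ, w0 γ ≤ w1 γ) → ∀ K,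
      0 ≤ ∑ γ, w1 γ * gA4u (Z γ) K + ∑ γ, w0 γ * gA4l (Z γ) K := fun w0 w1 a b c d K => by
    rw [← Finset.sum_add_distrib]; exact hB4 w0 w1 a b c d K
  have a := fun K => hB2 _ w11m (fun γ => n1 _) K; have b := fun K => hB2 _ w10m (fun γ => n1 _) K
  have c := fun K => hB2 _ w01m (fun γ => n0 _) K; have d := fun K => hB2 _ w00m (fun γ => n0 _) K
  have e := fun K => i3 _ _ w00m w01m (fun γ => n0 _) l_00_01 K; have f := fun K => i3 _ _ w00m w11m (fun γ => n0 _) l_00_11 K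
  have g := fun K => i3 _ _ w10m w11m (fun γ => n1 _) l_10_11 K; have h := fun K => i3 _ _ w00m w10m (fun γ => n0 _) l_00_10 K
  have e4 := fun K => i4 _ _ w00m w01m (fun γ => n0 _) l_00_01 K; have f4 := fun K => i4 _ _ w00m w11m (fun γ => n0 _) l_00_11 K
  have g4 := fun K => i4 _ _ w10m w11m (fun γ => n1 _) l_10_11 K; have h4 := fun K => i4 _ _ w00m w10m (fun γ => n0 _) l_00_10 K
  have b11 := fun K => i4 _ _ w11m w11m (fun γ => n1 _) (fun γ => le_rfl) K
  have b10 := fun K => i4 _ _ w10m w10m (fun γ => n1 _) (fun γ => le_rfl) K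
  have b01 := fun K => i4 _ _ w01m w01m (fun γ => n0 _) (fun γ => le_rfl) K
  have b00 := fun K => i4 _ _ w00m w00m (fun γ => n0 _) (fun γ => le_rfl) K
  have A := a (J - (Y β).t0.L - 1); have A' := a (J - (Y β).t1.L - 1); have Bq := b (J - (Y β).t0.L - 1); have Bq' := b (J - (Y β).t1.L - 1)
  have C := c (J - (Y β).t0.L - 1); have C' := c (J - (Y β).t1.L - 1); have D := d (J - (Y β).t0.L - 1); have D' := d (J - (Y β).t1.L - 1)
  have E := e (J - (Y β).t0.L - 1); have E' := e (J - (Y β).t1.L - 1); have Fq := f (J - (Y β).t0.L - 1); have Fq' := f (J - (Y β).t1.L - 1)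
  have G := g (J - (Y β).t0.L - 1); have G' := g (J - (Y β).t1.L - 1); have Hq := h (J - (Y β).t0.L - 1); have Hq' := h (J - (Y β).t1.L - 1)
  have E4 := e4 (J - (Y β).t0.L - 1); have E4' := e4 (J - (Y β).t1.L - 1); have F4 := f4 (J - (Y β).t0.L - 1); have F4' := f4 (J - (Y β).t1.L - 1)
  have G4 := g4 (J - (Y β).t0.L - 1); have G4' := g4 (J - (Y β).t1.L - 1); have H4 := h4 (J - (Y β).t0.L - 1); have H4' := h4 (J - (Y β).t1.L - 1)
  have B11 := b11 (J - (Y β).t0.L - 1); have B11' := b11 (J - (Y β).t1.L - 1); have B10 := b10 (J - (Y β).t0.L - 1); have B10' := b10 (J - (Y β).t1.L - 1)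
  have B01 := b01 (J - (Y β).t0.L - 1); have B01' := b01 (J - (Y β).t1.L - 1); have B00 := b00 (J - (Y β).t0.L - 1); have B00' := b00 (J - (Y β).t1.L - 1)
  clear a b c d e f g h e4 f4 g4 h4 b11 b10 b01 b00 i3 i4
  simp only [gA2, gA3u, gA3l, gA4u, gA4l] at A A' Bq Bq' C C' D D' E E' Fq Fq' G G' Hq Hq' E4 E4' F4 F4' G4 G4' H4 H4' B11 B11' B10 B10' B01 B01' B00 B00'
  generalize (Y β) = dy at *
  obtain ⟨⟨L0, c0, cb0⟩, ⟨L1, c1, cb1⟩⟩ := dy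
  simp only [BDat.type] at *
  subst hcv
  cases c1 <;> cases cb0 <;> cases cb1 <;>
    simp only [Cert.certZ3, Cert.isC, Prod.mk.injEq, Bool.false_eq_true, Bool.true_eq_false, and_true, and_false,
      and_self, ite_true, ite_false, zero_mul, mul_zero, mul_one, zero_add, add_zero, two_mul,
      Int.cast_add, Int.cast_zero, mul_add, Finset.sum_add_distrib] <;>
    first | positivity | linarith

omit [Fintype B] in
/-- **the `z`-half of the (B3) certificate is nonnegative** (per fixed `y`-configuration). [folklore] -/
theorem certZ3_nonneg (Y : B → BDat) (Z : B' → BDat)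
    (hB2 : ∀ h : B' → ℝ, Monotone h → (∀ γ, 0 ≤ h γ) → ∀ K : ℤ, 0 ≤ ∑ γ, h γ * gA2 (Z γ) K)
    (hB3 : ∀ h0 h1 : B' → ℝ, Monotone h0 → Monotone h1 → (∀ γ, 0 ≤ h0 γ) → (∀ γ, h0 γ ≤ h1 γ) → ∀ K : ℤ,
      0 ≤ ∑ γ, (h1 γ * gA3u (Z γ) K + h0 γ * gA3l (Z γ) K))
    (hB4 : ∀ h0 h1 : B' → ℝ, Monotone h0 → Monotone h1 → (∀ γ, 0 ≤ h0 γ) → (∀ γ, h0 γ ≤ h1 γ) → ∀ K : ℤ,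
      0 ≤ ∑ γ, (h1 γ * gA4u (Z γ) K + h0 γ * gA4l (Z γ) K))
    {H0 H1 : Bool × (B × B') → ℝ} (m0 : Monotone H0) (m1 : Monotone H1) (n0 : ∀ p, 0 ≤ H0 p) (le : ∀ p, H0 p ≤ H1 p) (J : ℤ) (β : B) :
    0 ≤ ∑ γ, (H1 (true, (β, γ)) * ((Cert.certZ3 (Y β).type (Z γ).type ((J - (Y β).t0.L - 1) - (Z γ).t0.L)
        ((J - (Y β).t1.L - 1) - (Z γ).t0.L)).1 : ℝ)
      + H1 (false, (β, γ)) * ((Cert.certZ3 (Y β).type (Z γ).type ((J - (Y β).t0.L - 1) - (Z γ).t0.L)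
        ((J - (Y β).t1.L - 1) - (Z γ).t0.L)).2.1 : ℝ)
      + H0 (true, (β, γ)) * ((Cert.certZ3 (Y β).type (Z γ).type ((J - (Y β).t0.L - 1) - (Z γ).t0.L)
        ((J - (Y β).t1.L - 1) - (Z γ).t0.L)).2.2.1 : ℝ)
      + H0 (false, (β, γ)) * ((Cert.certZ3 (Y β).type (Z γ).type ((J - (Y β).t0.L - 1) - (Z γ).t0.L)
        ((J - (Y β).t1.L - 1) - (Z γ).t0.L)).2.2.2 : ℝ)) := by
  rcases Bool.eq_false_or_eq_true ((Y β).t0.c) with hc | hc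
  · exact certZ3_nonneg_t Y Z hB2 hB3 hB4 m0 m1 n0 le J β hc
  · exact certZ3_nonneg_f Y Z hB2 hB3 hB4 m0 m1 n0 le J β hc


/-- **Base (B3) of the root-form reduction (abstract form): `M̃_{g ∥ (B_y·B_z)} ≥ 0`.**  For two abstract one-special boxes with consistent local
types satisfying A2, A3n, A4n against monotone nested nonnegative weights, and with the contracted AND of the series pair nonnegative against
monotone nonnegative weights (a `q`-free AND⁺ instance for real pairs), the nested root functional of `g ∥ (B_y · B_z)` (a fresh parallel free
edge over the series pair) is nonnegative against every monotone nested nonnegative weight pair. Proof: the 84-term certificate of file 61h,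
regrouped box by box per sub-slot (`certY3_nonneg`, `certZ3_nonneg`), its two pair terms, and the four-sub-slot transport `four_slot` of the
residual table `Cert.rho3_nonneg`. [folklore] -/
theorem serPair_parE_Mt_nonneg (Y : B → BDat) (Z : B' → BDat)
    (hcY : ∀ β, Cert.consistentB (Y β).type = true) (hcZ : ∀ γ, Cert.consistentB (Z γ).type = true)
    (hA2 : ∀ h : B → ℝ, Monotone h → (∀ β, 0 ≤ h β) → ∀ K : ℤ, 0 ≤ ∑ β, h β * gA2 (Y β) K)
    (hA3 : ∀ h0 h1 : B → ℝ, Monotone h0 → Monotone h1 → (∀ β, 0 ≤ h0 β) → (∀ β, h0 β ≤ h1 β) → ∀ K : ℤ,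
      0 ≤ ∑ β, (h1 β * gA3u (Y β) K + h0 β * gA3l (Y β) K))
    (hA4 : ∀ h0 h1 : B → ℝ, Monotone h0 → Monotone h1 → (∀ β, 0 ≤ h0 β) → (∀ β, h0 β ≤ h1 β) → ∀ K : ℤ,
      0 ≤ ∑ β, (h1 β * gA4u (Y β) K + h0 β * gA4l (Y β) K))
    (hB2 : ∀ h : B' → ℝ, Monotone h → (∀ γ, 0 ≤ h γ) → ∀ K : ℤ, 0 ≤ ∑ γ, h γ * gA2 (Z γ) K)
    (hB3 : ∀ h0 h1 : B' → ℝ, Monotone h0 → Monotone h1 → (∀ γ, 0 ≤ h0 γ) → (∀ γ, h0 γ ≤ h1 γ) → ∀ K : ℤ,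
      0 ≤ ∑ γ, (h1 γ * gA3u (Z γ) K + h0 γ * gA3l (Z γ) K))
    (hB4 : ∀ h0 h1 : B' → ℝ, Monotone h0 → Monotone h1 → (∀ γ, 0 ≤ h0 γ) → (∀ γ, h0 γ ≤ h1 γ) → ∀ K : ℤ,
      0 ≤ ∑ γ, (h1 γ * gA4u (Z γ) K + h0 γ * gA4l (Z γ) K))
    (hCon : ∀ h : B × B' → ℝ, Monotone h → (∀ p, 0 ≤ h p) → ∀ K : ℤ, 0 ≤ ∑ p, h p * (serPair Y Z p).andCon K)
    {H0 H1 : Bool × (B × B') → ℝ} (m0 : Monotone H0) (m1 : Monotone H1) (n0 : ∀ p, 0 ≤ H0 p) (le : ∀ p, H0 p ≤ H1 p) (J : ℤ) :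
    0 ≤ Mt (parE (serPair Y Z)) H0 H1 J := by
  have n1 : ∀ p, 0 ≤ H1 p := fun p => (n0 p).trans (le p)
  -- threshold bookkeeping between the table (offsets from k) and the halves (absolute thresholds)
  have hy : ∀ p : B × B', Cert.certY3 (Y p.1).type (Z p.2).type (J - (Z p.2).t0.L - (Y p.1).t0.L - 1)
      (J - (Z p.2).t0.L - (Y p.1).t0.L - (Z p.2).type.dL - 1)
      = Cert.certY3 (Y p.1).type (Z p.2).type ((J - (Z p.2).t0.L - 1) - (Y p.1).t0.L) ((J - (Z p.2).t1.L - 1) - (Y p.1).t0.L) := by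
    intro p
    have hd : (Z p.2).type.dL = (Z p.2).t1.L - (Z p.2).t0.L := rfl
    have h2 : J - (Z p.2).t0.L - (Y p.1).t0.L - 1 = (J - (Z p.2).t0.L - 1) - (Y p.1).t0.L := by ring
    have h3 : J - (Z p.2).t0.L - (Y p.1).t0.L - (Z p.2).type.dL - 1 = (J - (Z p.2).t1.L - 1) - (Y p.1).t0.L := by rw [hd]; ring
    rw [h3, h2]
  have hz : ∀ p : B × B', Cert.certZ3 (Y p.1).type (Z p.2).type (J - (Z p.2).t0.L - (Y p.1).t0.L - 1)
      (J - (Z p.2).t0.L - (Y p.1).t0.L - (Y p.1).type.dL - 1)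
      = Cert.certZ3 (Y p.1).type (Z p.2).type ((J - (Y p.1).t0.L - 1) - (Z p.2).t0.L) ((J - (Y p.1).t1.L - 1) - (Z p.2).t0.L) := by
    intro p
    have hd : (Y p.1).type.dL = (Y p.1).t1.L - (Y p.1).t0.L := rfl
    have h2 : J - (Z p.2).t0.L - (Y p.1).t0.L - 1 = (J - (Y p.1).t0.L - 1) - (Z p.2).t0.L := by ring
    have h3 : J - (Z p.2).t0.L - (Y p.1).t0.L - (Y p.1).type.dL - 1 = (J - (Y p.1).t1.L - 1) - (Z p.2).t0.L := by rw [hd]; ring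
    rw [h3, h2]
  have key : ∀ p : B × B',
      4 * (H1 (true, p) * (parE (serPair Y Z) (true, p)).slot1 J + H0 (true, p) * (parE (serPair Y Z) (true, p)).slot0 J)
      + 4 * (H1 (false, p) * (parE (serPair Y Z) (false, p)).slot1 J + H0 (false, p) * (parE (serPair Y Z) (false, p)).slot0 J)
      = (H1 (true, p) * ((Cert.certY3 (Y p.1).type (Z p.2).type ((J - (Z p.2).t0.L - 1) - (Y p.1).t0.L) ((J - (Z p.2).t1.L - 1) - (Y p.1).t0.L)).1 : ℝ) + H1 (false, p) * ((Cert.certY3 (Y p.1).type (Z p.2).type ((J - (Z p.2).t0.L - 1) - (Y p.1).t0.L) ((J - (Z p.2).t1.L - 1) - (Y p.1).t0.L)).2.1 : ℝ) + H0 (true, p) * ((Cert.certY3 (Y p.1).type (Z p.2).type ((J - (Z p.2).t0.L - 1) - (Y p.1).t0.L) ((J - (Z p.2).t1.L - 1) - (Y p.1).t0.L)).2.2.1 : ℝ) + H0 (false, p) * ((Cert.certY3 (Y p.1).type (Z p.2).type ((J - (Z p.2).t0.L - 1) - (Y p.1).t0.L) ((J - (Z p.2).t1.L - 1) - (Y p.1).t0.L)).2.2.2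 : ℝ))
        + (H1 (true, p) * ((Cert.certZ3 (Y p.1).type (Z p.2).type ((J - (Y p.1).t0.L - 1) - (Z p.2).t0.L) ((J - (Y p.1).t1.L - 1) - (Z p.2).t0.L)).1 : ℝ) + H1 (false, p) * ((Cert.certZ3 (Y p.1).type (Z p.2).type ((J - (Y p.1).t0.L - 1) - (Z p.2).t0.L) ((J - (Y p.1).t1.L - 1) - (Z p.2).t0.L)).2.1 : ℝ) + H0 (true, p) * ((Cert.certZ3 (Y p.1).type (Z p.2).type ((J - (Y p.1).t0.L - 1) - (Z p.2).t0.L) ((J - (Y p.1).t1.L - 1) - (Z p.2).t0.L)).2.2.1 : ℝ) + H0 (false, p) * ((Cert.certZ3 (Y p.1).type (Z p.2).type ((J - (Y p.1).t0.L - 1) - (Z p.2).t0.L) ((J - (Y p.1).t1.L - 1) - (Z p.2).t0.L)).2.2.2 : ℝ))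
        + ((4 * H0 (true, p)) * (serPair Y Z p).andCon J + (4 * H1 (false, p)) * (serPair Y Z p).andCon J)
        + (H1 (true, p) * ((Cert.rho3 (Y p.1).type (Z p.2).type (J - (Z p.2).t0.L - (Y p.1).t0.L)).1 : ℝ) + H1 (false, p) * ((Cert.rho3 (Y p.1).type (Z p.2).type (J - (Z p.2).t0.L - (Y p.1).t0.L)).2.1 : ℝ) + H0 (true, p) * ((Cert.rho3 (Y p.1).type (Z p.2).type (J - (Z p.2).t0.L - (Y p.1).t0.L)).2.2.1 : ℝ) + H0 (false, p) * ((Cert.rho3 (Y p.1).type (Z p.2).type (J - (Z p.2).t0.L - (Y p.1).t0.L)).2.2.2 : ℝ)) := by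
    intro p
    rw [slot1_linkP, slot0_linkP, slot1_linkP, slot0_linkP, andCon_linkS]
    simp only [Cert.rho3, hy p, hz p]
    push_cast; ring
  have Ytot : 0 ≤ ∑ p : B × B', (H1 (true, p) * ((Cert.certY3 (Y p.1).type (Z p.2).type ((J - (Z p.2).t0.L - 1) - (Y p.1).t0.L) ((J - (Z p.2).t1.L - 1) - (Y p.1).t0.L)).1 : ℝ) + H1 (false, p) * ((Cert.certY3 (Y p.1).type (Z p.2).type ((J - (Z p.2).t0.L - 1) - (Y p.1).t0.L) ((J - (Z p.2).t1.L - 1) - (Y p.1).t0.L)).2.1 : ℝ) + H0 (true, p) * ((Cert.certY3 (Y p.1).type (Z p.2).type ((J - (Z p.2).t0.L - 1) - (Y p.1).t0.L) ((J - (Z p.2).t1.L - 1) - (Y p.1).t0.L)).2.2.1 : ℝ) + H0 (false, p) * ((Cert.certY3 (Y p.1).type (Z p.2).type ((J - (Z p.2).t0.L - 1) - (Y p.1).t0.L) ((J - (Z p.2).t1.L - 1) - (Y p.1).t0.L)).2.2.2 : ℝ)) := by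
    rw [Fintype.sum_prod_type_right]
    exact Finset.sum_nonneg fun γ _ => certY3_nonneg Y Z hA2 hA3 hA4 m0 m1 n0 le J γ
  have Ztot : 0 ≤ ∑ p : B × B', (H1 (true, p) * ((Cert.certZ3 (Y p.1).type (Z p.2).type ((J - (Y p.1).t0.L - 1) - (Z p.2).t0.L) ((J - (Y p.1).t1.L - 1) - (Z p.2).t0.L)).1 : ℝ) + H1 (false, p) * ((Cert.certZ3 (Y p.1).type (Z p.2).type ((J - (Y p.1).t0.L - 1) - (Z p.2).t0.L) ((J - (Y p.1).t1.L - 1) - (Z p.2).t0.L)).2.1 : ℝ) + H0 (true, p) * ((Cert.certZ3 (Y p.1).type (Z p.2).type ((J - (Y p.1).t0.L - 1) - (Z p.2).t0.L) ((J - (Y p.1).t1.L - 1) - (Z p.2).t0.L)).2.2.1 : ℝ) + H0 (false, p) * ((Cert.certZ3 (Y p.1).type (Z p.2).type ((J - (Y p.1).t0.L - 1) - (Z p.2).t0.L) ((J - (Y p.1).t1.L - 1) - (Z p.2).t0.L)).2.2.2 : ℝ)) := by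
    rw [Fintype.sum_prod_type]
    exact Finset.sum_nonneg fun β _ => certZ3_nonneg Y Z hB2 hB3 hB4 m0 m1 n0 le J β
  have Ptot : 0 ≤ ∑ p : B × B', ((4 * H0 (true, p)) * (serPair Y Z p).andCon J + (4 * H1 (false, p)) * (serPair Y Z p).andCon J) := by
    rw [Finset.sum_add_distrib]
    refine add_nonneg (hCon _ ?_ (fun p => by have := n0 (true, p); positivity) J) (hCon _ ?_ (fun p => by have := n1 (false, p); positivity) J)
    · exact fun p q hpq => by have := m0 (Prod.mk_le_mk.2 ⟨le_rfl, hpq⟩ : ((true, p) : Bool × (B × B')) ≤ (true, q)); linarith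
    · exact fun p q hpq => by have := m1 (Prod.mk_le_mk.2 ⟨le_rfl, hpq⟩ : ((false, p) : Bool × (B × B')) ≤ (false, q)); linarith
  have Rtot : 0 ≤ ∑ p : B × B', (H1 (true, p) * ((Cert.rho3 (Y p.1).type (Z p.2).type (J - (Z p.2).t0.L - (Y p.1).t0.L)).1 : ℝ) + H1 (false, p) * ((Cert.rho3 (Y p.1).type (Z p.2).type (J - (Z p.2).t0.L - (Y p.1).t0.L)).2.1 : ℝ) + H0 (true, p) * ((Cert.rho3 (Y p.1).type (Z p.2).type (J - (Z p.2).t0.L - (Y p.1).t0.L)).2.2.1 : ℝ) + H0 (false, p) * ((Cert.rho3 (Y p.1).type (Z p.2).type (J - (Z p.2).t0.L - (Y p.1).t0.L)).2.2.2 : ℝ)) := by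
    refine Finset.sum_nonneg fun p _ => ?_
    obtain ⟨c1, c2, c3, c4, c5⟩ := Cert.rho3_nonneg (Y p.1).type (Z p.2).type (hcY p.1) (hcZ p.2) (J - (Z p.2).t0.L - (Y p.1).t0.L)
    have c1' : (0 : ℝ) ≤ ((Cert.rho3 (Y p.1).type (Z p.2).type (J - (Z p.2).t0.L - (Y p.1).t0.L)).1 : ℝ) := by exact_mod_cast c1
    have c2' : (0 : ℝ) ≤ ((Cert.rho3 (Y p.1).type (Z p.2).type (J - (Z p.2).t0.L - (Y p.1).t0.L)).1 : ℝ) + ((Cert.rho3 (Y p.1).type (Z p.2).type (J - (Z p.2).t0.L - (Y p.1).t0.L)).2.1 : ℝ) := by exact_mod_cast c2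
    have c3' : (0 : ℝ) ≤ ((Cert.rho3 (Y p.1).type (Z p.2).type (J - (Z p.2).t0.L - (Y p.1).t0.L)).1 : ℝ) + ((Cert.rho3 (Y p.1).type (Z p.2).type (J - (Z p.2).t0.L - (Y p.1).t0.L)).2.2.1 : ℝ) := by exact_mod_cast c3
    have c4' : (0 : ℝ) ≤ ((Cert.rho3 (Y p.1).type (Z p.2).type (J - (Z p.2).t0.L - (Y p.1).t0.L)).1 : ℝ) + ((Cert.rho3 (Y p.1).type (Z p.2).type (J - (Z p.2).t0.L - (Y p.1).t0.L)).2.1 : ℝ) + ((Cert.rho3 (Y p.1).type (Z p.2).type (J - (Z p.2).t0.L - (Y p.1).t0.L)).2.2.1 : ℝ) := by exact_mod_cast c4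
    have c5' : (0 : ℝ) ≤ ((Cert.rho3 (Y p.1).type (Z p.2).type (J - (Z p.2).t0.L - (Y p.1).t0.L)).1 : ℝ) + ((Cert.rho3 (Y p.1).type (Z p.2).type (J - (Z p.2).t0.L - (Y p.1).t0.L)).2.1 : ℝ) + ((Cert.rho3 (Y p.1).type (Z p.2).type (J - (Z p.2).t0.L - (Y p.1).t0.L)).2.2.1 : ℝ) + ((Cert.rho3 (Y p.1).type (Z p.2).type (J - (Z p.2).t0.L - (Y p.1).t0.L)).2.2.2 : ℝ) := by exact_mod_cast c5
    have h4 := four_slot (H1 (true, p)) (H1 (false, p)) (H0 (true, p)) (H0 (false, p)) _ _ _ _ (n0 _) (mono_b m0 p) (le _) (le _)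
      (mono_b m1 p) c1' c2' c3' c4' c5'
    linarith
  have total : 4 * Mt (parE (serPair Y Z)) H0 H1 J = ∑ p : B × B', ((H1 (true, p) * ((Cert.certY3 (Y p.1).type (Z p.2).type ((J - (Z p.2).t0.L - 1) - (Y p.1).t0.L) ((J - (Z p.2).t1.L - 1) - (Y p.1).t0.L)).1 : ℝ) + H1 (false, p) * ((Cert.certY3 (Y p.1).type (Z p.2).type ((J - (Z p.2).t0.L - 1) - (Y p.1).t0.L) ((J - (Z p.2).t1.L - 1) - (Y p.1).t0.L)).2.1 : ℝ) + H0 (true, p) * ((Cert.certY3 (Y p.1).type (Z p.2).type ((J - (Z p.2).t0.L - 1) - (Y p.1).t0.L) ((J - (Z p.2).t1.L - 1) - (Y p.1).t0.L)).2.2.1 : ℝ) + H0 (false, p) * ((Cert.certY3 (Y p.1).type (Z p.2).type ((J - (Z p.2).t0.L - 1) - (Y p.1).t0.L) ((J - (Z p.2).t1.L - 1) - (Y p.1).t0.L)).2.2.2 : ℝ)) + (H1 (true, p) * ((Cert.certZ3 (Y p.1).type (Z p.2).type ((J - (Y p.1).t0.L - 1) - (Z p.2).t0.L) ((J - (Y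 p.1).t1.L - 1) - (Z p.2).t0.L)).1 : ℝ) + H1 (false, p) * ((Cert.certZ3 (Y p.1).type (Z p.2).type ((J - (Y p.1).t0.L - 1) - (Z p.2).t0.L) ((J - (Y p.1).t1.L - 1) - (Z p.2).t0.L)).2.1 : ℝ) + H0 (true, p) * ((Cert.certZ3 (Y p.1).type (Z p.2).type ((J - (Y p.1).t0.L - 1) - (Z p.2).t0.L) ((J - (Y p.1).t1.L - 1) - (Z p.2).t0.L)).2.2.1 : ℝ) + H0 (false, p) * ((Cert.certZ3 (Y p.1).type (Z p.2).type ((J - (Y p.1).t0.L - 1) - (Z p.2).t0.L) ((J - (Y p.1).t1.L - 1) - (Z p.2).t0.L)).2.2.2 : ℝ)) + ((4 * H0 (true, p)) * (serPair Y Z p).andCon J + (4 * H1 (false, p)) * (serPair Y Z p).andCon J) + (H1 (true, p) * ((Cert.rho3 (Y p.1).type (Z p.2).type (J - (Z p.2).t0.L - (Y p.1).t0.L)).1 : ℝ) + H1 (false, p) * ((Cert.rho3 (Y p.1).type (Z p.2).type (J - (Z p.2).t0.L - (Y p.1).t0.L)).2.1 : ℝ) + H0 (true, p) * ((Cert.rho3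 (Y p.1).type (Z p.2).type (J - (Z p.2).t0.L - (Y p.1).t0.L)).2.2.1 : ℝ) + H0 (false, p) * ((Cert.rho3 (Y p.1).type (Z p.2).type (J - (Z p.2).t0.L - (Y p.1).t0.L)).2.2.2 : ℝ))) := by
    unfold Mt
    rw [Fintype.sum_prod_type, Fintype.sum_bool, ← Finset.sum_add_distrib, Finset.mul_sum]
    exact Finset.sum_congr rfl fun p _ => by rw [mul_add]; exact key p
  have h4 : 0 ≤ 4 * Mt (parE (serPair Y Z)) H0 H1 J := by
    rw [total, Finset.sum_add_distrib, Finset.sum_add_distrib, Finset.sum_add_distrib]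
    exact add_nonneg (add_nonneg (add_nonneg Ytot Ztot) Ptot) Rtot
  linarith

end Halves2

end BasePar

end RootForm

end FK

end Summit.CriticalPhenomena.PercolationContinuityZ3.Theorems
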